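import Mathlib.Algebra.BigOperators.Intervals
import Mathlib.Algebra.Group.Pi.Lemmas
import Mathlib.Algebra.Order.Group.Int
import Mathlib.Order.Interval.Set.Pi
import Literature.Probability.LatticeModels.LatticeGraph
import HarnessLib

/-!
# Cubical cochains on `ℤ^d` with values in an abelian group: coboundaries and Poincaré lemmas

Support file for the low-temperature (contour) expansion of abelian lattice gauge theories
(discharge of `Literature.Barriers.QuantumFields.ZnHiggsPhaseD4` via the torus core facts of
`DiscreteSubgroupFreezingProofs.lean`). Discrete exterior calculus on the hypercubic lattice in
the positively-oriented-cell convention (Forsström–Lenells–Viklund 2022 §2, Forsström 2022 §2,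
"discrete exterior calculus"; Chatterjee 2020 §2): a `k`-cochain assigns a group element to each
positively oriented `k`-cell `(x; i₁ < ⋯ < i_k)` of `ℤ^d` (`x ∈ ℤ^d = Site d` the base point).
We represent `1`-cochains as `θ : Site d → Fin d → A`, `2`-cochains as
`ω : Site d → Fin d → Fin d → A` (all index pairs; the genuine plaquettes are `i < j`, and the
cochains produced here are alternating: `ω x j i = -ω x i j`, `ω x i i = 0`) and `3`-cochains as
functions of `(x, i, j, k)`, with the cubical coboundaries

* `d₀ f x i = f (x + eᵢ) - f x`,
* `d₁ θ x i j = θ x i + θ (x + eᵢ) j - θ (x + eⱼ) i - θ x j` (for a lattice gauge field `U` and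
  abelian `G` this is the plaquette variable `U_p`, written additively),
* `d₂ ω x i j k = (ω (x+eᵢ) j k - ω x j k) - (ω (x+eⱼ) i k - ω x i k) + (ω (x+e_k) i j - ω x i j)`,
  i.e. `∂ᵢ ω_{jk} - ∂ⱼ ω_{ik} + ∂_k ω_{ij}` with `∂ᵢ h (x) = h (x + eᵢ) - h x` (the flux through the
  boundary of the `3`-cell, in the orientation of Forsström–Lenells–Viklund §2.3.2).

## Main results (everything is proved)

* `d₁_d₀`, `d₂_d₁`: `d ∘ d = 0` (the Bianchi identity `d(dU) = 0` in the abelian case).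
* `LatticeForm.exists_primitive_of_axisInvariant` (an `H¹`-type lemma with supports): a closed
  `1`-cochain which is invariant along an axis `ℓ`, has no `ℓ`-component, and is supported in a
  box in the remaining coordinates, is `d₀ g` of an `ℓ`-invariant `0`-cochain supported in the
  same box (needs three distinct axes, i.e. the situation of `ℤ^d`, `d ≥ 3`).
* `LatticeForm.exists_d₁_eq_of_d₂_eq_zero` (**Poincaré lemma with compact supports in degree
  two**, `H²_c(ℤ^d; A) = 0` for `d ≥ 3`, with support control): an alternating closed `2`-cochain
  supported in a box `[a, b] ⊆ ℤ^d` is `d₁ θ` for a `1`-cochain `θ` supported in the same box.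
  The proof is the lattice version of integration along the fibres of `ℤ^d → ℤ^{d-1}`
  (Bott–Tu style): integrate along the axis `ℓ`, correct by the primitive of the column sums
  (the `H¹` lemma), and observe that the remainder is `ℓ`-invariant and vanishes below the box.

These are the topological inputs "small closed vortices are boundaries" and "the primitive of a
small vortex lives in its bounding box" of the contour expansion (cf. Forsström–Lenells–Viklund
2022, Lemmas 2.2–2.4 (Poincaré and Hodge-type lemmas for boxes in `ℤ⁴`)).

## References

* M. P. Forsström, J. Lenells, F. Viklund, *Wilson loops in finite Abelian lattice gauge
  theories*, Ann. Inst. H. Poincaré Probab. Stat. 58 (2022), §2 (discrete exterior calculus,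
  Poincaré lemma). [ForsstromLenellsViklund2022]
* M. P. Forsström, *Decay of correlations in finite Abelian lattice gauge theories*, Comm. Math.
  Phys. 393 (2022), §2. [Forsstrom2022]
-/

open Finset Function

namespace Literature.MathematicalPhysics.QuantumFieldTheory

namespace LatticeForm

open Literature.Probability.LatticeModels (Site)

variable {d : ℕ} {A : Type*} [AddCommGroup A]

/-! ### Unit vectors, translations and coordinate updates in `ℤ^d` -/

/-- The unit lattice vector `eᵢ ∈ ℤ^d`. [folklore] -/
abbrev e (i : Fin d) : Site d := Pi.single i 1

/-- Coordinates of `x + c eᵢ`: the `i`-th moves by `c`. [folklore] -/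
@[simp] theorem add_single_apply_self (x : Site d) (i : Fin d) (c : ℤ) :
    (x + Pi.single i c : Site d) i = x i + c := by simp

/-- Coordinates of `x + c eᵢ`: the others do not move. [folklore] -/
theorem add_single_apply_of_ne (x : Site d) {i m : Fin d} (h : m ≠ i) (c : ℤ) :
    (x + Pi.single i c : Site d) m = x m := by simp [Pi.single_eq_of_ne h]

/-- Updating the `ℓ`-th coordinate commutes with a translation in another direction. [folklore] -/
theorem update_add_single_of_ne (x : Site d) {ℓ i : Fin d} (h : i ≠ ℓ) (t c : ℤ) :
    update (x + Pi.single i c) ℓ t = update x ℓ t + Pi.single i c := by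
  funext m
  by_cases hm : m = ℓ
  · subst hm; simp [Pi.single_eq_of_ne (Ne.symm h)]
  · simp [update_of_ne hm]

/-- Updating the `ℓ`-th coordinate absorbs a translation along `eℓ`. [folklore] -/
@[simp] theorem update_add_single_self (x : Site d) (ℓ : Fin d) (t c : ℤ) :
    update (x + Pi.single ℓ c) ℓ t = update x ℓ t := by
  funext m
  by_cases hm : m = ℓ
  · subst hm; simp
  · simp [update_of_ne hm, Pi.single_eq_of_ne hm]

/-- Translating an updated point along `eℓ` updates to the next value. [folklore] -/
theorem update_add_single_eq (x : Site d) (ℓ : Fin d) (t c : ℤ) :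
    update x ℓ t + Pi.single ℓ c = update x ℓ (t + c) := by
  funext m
  by_cases hm : m = ℓ
  · subst hm; simp
  · simp [update_of_ne hm, Pi.single_eq_of_ne hm]

/-- A function invariant under `x ↦ x + eℓ` does not depend on the `ℓ`-th coordinate. [folklore] -/
theorem apply_update_eq_of_invariant {β : Sort*} {f : Site d → β} {ℓ : Fin d}
    (hf : ∀ x, f (x + e ℓ) = f x) (x : Site d) (t : ℤ) : f (update x ℓ t) = f x := by
  -- `f (update x ℓ (x ℓ + n)) = f x` and `f (update x ℓ (x ℓ - n)) = f x` for `n : ℕ`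
  have hup : ∀ (y : Site d) (n : ℕ), f (update y ℓ (y ℓ + n)) = f y := by
    intro y n
    induction n with
    | zero => simp
    | succ n ih =>
      have : update y ℓ (y ℓ + (n + 1 : ℕ)) = update y ℓ (y ℓ + n) + e ℓ := by
        rw [update_add_single_eq]; push_cast; ring_nf
      rw [this, hf, ih]
  have hdown : ∀ (y : Site d) (n : ℕ), f (update y ℓ (y ℓ - n)) = f y := by
    intro y n
    have h := hup (update y ℓ (y ℓ - n)) n
    simp only [update_self, update_idem, sub_add_cancel, update_eq_self] at h
    exact h.symm
  rcases le_or_gt (x ℓ) t with h | h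
  · obtain ⟨n, hn⟩ := Int.le.dest h
    rw [← hn]; exact hup x n
  · obtain ⟨n, hn⟩ := Int.le.dest h.le
    have : t = x ℓ - n := by omega
    rw [this]; exact hdown x n

/-! ### The cubical coboundaries -/

/-- `d₀ f (x, i) = f(x + eᵢ) - f(x)`: the coboundary of a `0`-cochain (for gauge fields: a pure
gauge `g(x+eᵢ) g(x)⁻¹`, additively). [cite: ForsstromLenellsViklund2022, §2.3.2 (exterior derivative)] -/
def d₀ (f : Site d → A) : Site d → Fin d → A := fun x i => f (x + e i) - f x

/-- `d₁ θ (x; i, j) = θ(x,i) + θ(x+eᵢ,j) - θ(x+eⱼ,i) - θ(x,j)`: the coboundary of a `1`-cochain,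
i.e. the (additively written) plaquette variable of the abelian lattice gauge field `θ` around the
plaquette at `x` spanned by `eᵢ, eⱼ` (same orientation as `plaquetteHolonomy`). [cite: ForsstromLenellsViklund2022, §2.3.2 (exterior derivative, eq. for dσ)] -/
def d₁ (θ : Site d → Fin d → A) : Site d → Fin d → Fin d → A :=
  fun x i j => θ x i + θ (x + e i) j - θ (x + e j) i - θ x j

/-- `d₂ ω (x; i, j, k) = ∂ᵢ ω_{jk}(x) - ∂ⱼ ω_{ik}(x) + ∂_k ω_{ij}(x)`, `∂ᵢ h(x) = h(x + eᵢ) - h(x)`: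
the coboundary of a `2`-cochain — the oriented sum of `ω` over the six faces of the `3`-cell at
`x` spanned by `eᵢ, eⱼ, e_k`, in the orientation convention of the cited exterior derivative
`dω = ∑ ∂ᵢ ω_{j₁j₂} dxⁱ ∧ dx^{j₁} ∧ dx^{j₂}`. [cite: ForsstromLenellsViklund2022, §2.3.2 (exterior derivative)] -/
def d₂ (ω : Site d → Fin d → Fin d → A) : Site d → Fin d → Fin d → Fin d → A :=
  fun x i j k => (ω (x + e i) j k - ω x j k) - (ω (x + e j) i k - ω x i k) + (ω (x + e k) i j - ω x i j)

/-- `d₁` is alternating: antisymmetric in the two directions. [folklore] -/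
theorem d₁_swap (θ : Site d → Fin d → A) (x : Site d) (i j : Fin d) :
    d₁ θ x j i = -d₁ θ x i j := by
  simp only [d₁]; abel

/-- `d₁` vanishes on the diagonal. [folklore] -/
@[simp] theorem d₁_self (θ : Site d → Fin d → A) (x : Site d) (i : Fin d) : d₁ θ x i i = 0 := by
  simp only [d₁]; abel

/-- `d₁ ∘ d₀ = 0`. [cite: ForsstromLenellsViklund2022, §2.3.2 (dd = 0)] -/
theorem d₁_d₀ (f : Site d → A) : d₁ (d₀ f) = 0 := by
  funext x i j
  simp only [d₁, d₀, Pi.zero_apply]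
  rw [add_right_comm x (e i) (e j)]
  abel

/-- `d₂ ∘ d₁ = 0` (for gauge fields: the Bianchi identity `d(dU) = 0`, abelian case).
[cite: ForsstromLenellsViklund2022, §2.3.2 (dd = 0)] -/
theorem d₂_d₁ (θ : Site d → Fin d → A) : d₂ (d₁ θ) = 0 := by
  funext x i j k
  simp only [d₂, d₁, Pi.zero_apply]
  rw [add_right_comm x (e i) (e j), add_right_comm x (e i) (e k), add_right_comm x (e j) (e k)]
  abel

/-- `d₀`, `d₁`, `d₂` are additive: `d₁ (θ - θ') = d₁ θ - d₁ θ'`. [folklore] -/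
theorem d₁_sub (θ θ' : Site d → Fin d → A) : d₁ (θ - θ') = d₁ θ - d₁ θ' := by
  funext x i j; simp only [d₁, Pi.sub_apply]; abel

/-- `d₂ (ω - ω') = d₂ ω - d₂ ω'`. [folklore] -/
theorem d₂_sub (ω ω' : Site d → Fin d → Fin d → A) : d₂ (ω - ω') = d₂ ω - d₂ ω' := by
  funext x i j k; simp only [d₂, Pi.sub_apply]; abel

/-- `d₀ (g - g') = d₀ g - d₀ g'`. [folklore] -/
theorem d₀_sub (g g' : Site d → A) : d₀ (g - g') = d₀ g - d₀ g' := by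
  funext x i; simp only [d₀, Pi.sub_apply]; abel


/-! ### Sums along an axis -/

/-- `axisSum F ℓ a N x = ∑_{n < N} F (x with x_ℓ := a + n)`: the sum of `F` over `N` consecutive
points of the axis-`ℓ` line through `x`, starting at height `a` (the lattice "integral along the
fibre"). [folklore] -/
def axisSum {β : Type*} [AddCommMonoid β] (F : Site d → β) (ℓ : Fin d) (a : ℤ) (N : ℕ)
    (x : Site d) : β :=
  ∑ n ∈ Finset.range N, F (update x ℓ (a + n))

/-- An axis sum does not depend on the `ℓ`-th coordinate of the base point. [folklore] -/
@[simp] theorem axisSum_update {β : Type*} [AddCommMonoid β] (F : Site d → β) (ℓ : Fin d) (a : ℤ)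
    (N : ℕ) (x : Site d) (t : ℤ) : axisSum F ℓ a N (update x ℓ t) = axisSum F ℓ a N x := by
  simp [axisSum]

/-- An axis sum is invariant under translation along its axis. [folklore] -/
@[simp] theorem axisSum_add_single_self {β : Type*} [AddCommMonoid β] (F : Site d → β) (ℓ : Fin d)
    (a : ℤ) (N : ℕ) (x : Site d) : axisSum F ℓ a N (x + e ℓ) = axisSum F ℓ a N x := by
  simp [axisSum]

/-- Translating the base point in a transverse direction translates the summand. [folklore] -/
theorem axisSum_add_single_of_ne {β : Type*} [AddCommMonoid β] (F : Site d → β) {ℓ i : Fin d}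
    (h : i ≠ ℓ) (a : ℤ) (N : ℕ) (x : Site d) :
    axisSum F ℓ a N (x + e i) = axisSum (fun y => F (y + e i)) ℓ a N x := by
  simp [axisSum, update_add_single_of_ne x h]

/-- One more point: `axisSum F ℓ a (N+1) x = axisSum F ℓ a N x + F (x with x_ℓ := a + N)`. [folklore] -/
theorem axisSum_succ {β : Type*} [AddCommMonoid β] (F : Site d → β) (ℓ : Fin d) (a : ℤ) (N : ℕ)
    (x : Site d) : axisSum F ℓ a (N + 1) x = axisSum F ℓ a N x + F (update x ℓ (a + N)) := by
  simp [axisSum, Finset.sum_range_succ]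

/-- A non-vanishing axis sum has a non-vanishing summand. [folklore] -/
theorem exists_ne_zero_of_axisSum_ne_zero {β : Type*} [AddCommMonoid β] {F : Site d → β} {ℓ : Fin d}
    {a : ℤ} {N : ℕ} {x : Site d} (h : axisSum F ℓ a N x ≠ 0) :
    ∃ n : ℕ, n < N ∧ F (update x ℓ (a + n)) ≠ 0 := by
  obtain ⟨n, hn, hne⟩ := Finset.exists_ne_zero_of_sum_ne_zero h
  exact ⟨n, Finset.mem_range.1 hn, hne⟩

/-- **The lattice primitive along an axis.** `axisPrim F ℓ a x = ∑_{a ≤ t < x_ℓ} F(x with x_ℓ := t)`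
(empty for `x_ℓ ≤ a`). [folklore] -/
def axisPrim (F : Site d → A) (ℓ : Fin d) (a : ℤ) (x : Site d) : A :=
  axisSum F ℓ a (x ℓ - a).toNat x

/-- **Telescoping / fundamental theorem of calculus along an axis**: if `F` vanishes below height
`a`, then `axisPrim F (x + eℓ) - axisPrim F x = F x` for every `x`. [folklore] -/
theorem axisPrim_add_single_sub (F : Site d → A) (ℓ : Fin d) (a : ℤ)
    (hF : ∀ y : Site d, y ℓ < a → F y = 0) (x : Site d) :
    axisPrim F ℓ a (x + e ℓ) - axisPrim F ℓ a x = F x := by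
  unfold axisPrim
  rw [axisSum_add_single_self, add_single_apply_self]
  rcases lt_or_ge (x ℓ) a with h | h
  · have h1 : (x ℓ + 1 - a).toNat = 0 := Int.toNat_of_nonpos (by omega)
    have h2 : (x ℓ - a).toNat = 0 := Int.toNat_of_nonpos (by omega)
    rw [h1, h2, sub_self, hF x h]
  · have h1 : (x ℓ + 1 - a).toNat = (x ℓ - a).toNat + 1 := by omega
    rw [h1, axisSum_succ, add_sub_cancel_left]
    congr 1
    have : a + ((x ℓ - a).toNat : ℤ) = x ℓ := by omega
    rw [this, update_eq_self]

/-- Below height `a` the primitive vanishes. [folklore] -/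
theorem axisPrim_eq_zero_of_le (F : Site d → A) (ℓ : Fin d) (a : ℤ) {x : Site d} (hx : x ℓ ≤ a) :
    axisPrim F ℓ a x = 0 := by
  unfold axisPrim
  rw [Int.toNat_of_nonpos (by omega)]
  simp [axisSum]

/-- The primitive does not see the `ℓ`-th coordinate of the summand's base point beyond the
number of terms: `axisPrim F ℓ a (update x ℓ t) = axisSum F ℓ a (t - a).toNat x`. [folklore] -/
theorem axisPrim_update (F : Site d → A) (ℓ : Fin d) (a t : ℤ) (x : Site d) :
    axisPrim F ℓ a (update x ℓ t) = axisSum F ℓ a (t - a).toNat x := by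
  simp [axisPrim]

/-! ### An `H¹`-type lemma: primitives of axis-invariant closed `1`-cochains -/

/-- Support of a cochain component away from the axis `ℓ`: all coordinates other than the `ℓ`-th
lie in the box `[a, b]`. [folklore] -/
def InBoxAway (ℓ : Fin d) (a b x : Site d) : Prop := ∀ m, m ≠ ℓ → a m ≤ x m ∧ x m ≤ b m

/-- `InBoxAway` does not see the `ℓ`-th coordinate. [folklore] -/
theorem inBoxAway_update_iff {ℓ : Fin d} {a b x : Site d} {t : ℤ} :
    InBoxAway ℓ a b (update x ℓ t) ↔ InBoxAway ℓ a b x := by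
  constructor
  · intro h m hm; have := h m hm; rwa [update_of_ne hm] at this
  · intro h m hm; rw [update_of_ne hm]; exact h m hm

/-- **`H¹` with supports for axis-invariant cochains.** Let `ℓ, k, m` be three distinct axes of
`ℤ^d` and `Φ` a `1`-cochain with no `ℓ`-component, invariant along `eℓ`, closed (`d₁ Φ = 0`) and
supported, in the coordinates other than `ℓ`, in the box `[a, b]`. Then `Φ = d₀ g` for a
`0`-cochain `g` which is invariant along `eℓ` and supported in the same box. (`g` is the sum of
`Φ(·; k)` along the axis `k`; closedness makes `Φ - d₀ g` invariant along `e_k`, hence zero since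
it vanishes below the box; the total column sums form a translation-invariant function vanishing
far out in the direction `m`, hence vanish — this bounds the support of `g` from above.) This is
the lattice analogue of `H¹_c(ℝ^{d-1}) = 0`, `d - 1 ≥ 2`. [folklore] -/
theorem exists_primitive_of_axisInvariant {ℓ k m : Fin d} (hkℓ : k ≠ ℓ) (hmℓ : m ≠ ℓ)
    (hmk : m ≠ k) (Φ : Site d → Fin d → A) (a b : Site d)
    (h0 : ∀ x, Φ x ℓ = 0) (hinv : ∀ x i, Φ (x + e ℓ) i = Φ x i)
    (hcl : ∀ x i j, d₁ Φ x i j = 0)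
    (hsupp : ∀ x i, Φ x i ≠ 0 → InBoxAway ℓ a b x) :
    ∃ g : Site d → A, (∀ x, g (x + e ℓ) = g x) ∧ d₀ g = Φ ∧
      ∀ x, g x ≠ 0 → InBoxAway ℓ a b x := by
  -- the candidate: integrate `Φ(·; k)` along the axis `k`
  set F : Site d → A := fun y => Φ y k with hF
  have hFlow : ∀ y : Site d, y k < a k → F y = 0 := by
    intro y hy
    by_contra hne
    have := (hsupp y k hne) k hkℓ
    omega
  set g : Site d → A := axisPrim F k (a k) with hg
  -- (1) `g (x + e_k) - g x = Φ x k`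
  have hgk : ∀ x, g (x + e k) - g x = Φ x k := fun x => axisPrim_add_single_sub F k (a k) hFlow x
  -- (2) `g` is invariant along `eℓ`
  have hgℓ : ∀ x, g (x + e ℓ) = g x := by
    intro x
    simp only [hg, axisPrim, add_single_apply_of_ne x hkℓ,
      axisSum_add_single_of_ne _ (Ne.symm hkℓ) , hF, hinv]
  -- (3) `g (x + e_i) - g x = Φ x i` for `i ≠ k`
  have hgi : ∀ i, i ≠ k → ∀ x, g (x + e i) - g x = Φ x i := by
    intro i hik x
    by_cases hiℓ : i = ℓ
    · subst hiℓ; rw [hgℓ, sub_self, h0]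
    -- `Ψ x := Φ x i - (g (x + eᵢ) - g x)` is invariant along `e_k`
    have hΨ : ∀ y, Φ (y + e k) i - (g (y + e k + e i) - g (y + e k)) =
        Φ y i - (g (y + e i) - g y) := by
      intro y
      have hc := hcl y i k
      simp only [d₁] at hc
      have e1 : g (y + e k) = Φ y k + g y := by rw [← hgk y]; abel
      have e2 : g (y + e i + e k) = Φ (y + e i) k + g (y + e i) := by rw [← hgk (y + e i)]; abel
      have e3 : Φ (y + e k) i = Φ y i + Φ (y + e i) k - Φ y k := by
        have h' : Φ (y + e k) i - (Φ y i + Φ (y + e i) k - Φ y k) =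
            -(Φ y i + Φ (y + e i) k - Φ (y + e k) i - Φ y k) := by abel
        rw [hc, neg_zero] at h'
        exact sub_eq_zero.1 h'
      rw [add_right_comm y (e k) (e i), e1, e2, e3]
      abel
    -- hence it equals its value at height `a_k - 1`, which is zero
    have hΨ' : ∀ y, Φ y i - (g (y + e i) - g y) =
        Φ (update y k (a k - 1)) i - (g (update y k (a k - 1) + e i) - g (update y k (a k - 1))) :=
      fun y => (apply_update_eq_of_invariant (f := fun z => Φ z i - (g (z + e i) - g z)) hΨ y _).symm
    have hzero : Φ (update x k (a k - 1)) i -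
        (g (update x k (a k - 1) + e i) - g (update x k (a k - 1))) = 0 := by
      have hΦ : Φ (update x k (a k - 1)) i = 0 := by
        by_contra hne
        have := (hsupp _ i hne) k hkℓ
        simp only [update_self] at this
        omega
      have hg1 : g (update x k (a k - 1)) = 0 :=
        axisPrim_eq_zero_of_le F k (a k) (by simp)
      have hg2 : g (update x k (a k - 1) + e i) = 0 :=
        axisPrim_eq_zero_of_le F k (a k) (by rw [add_single_apply_of_ne _ (Ne.symm hik) ]; simp)
      rw [hΦ, hg1, hg2]; abel
    have := hΨ' x
    rw [hzero, sub_eq_zero] at this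
    exact this.symm
  -- (4) `d₀ g = Φ`
  have hd : d₀ g = Φ := by
    funext x i
    by_cases hik : i = k
    · subst hik; exact hgk x
    · exact hgi i hik x
  -- (5) the total column sums vanish: `g (x with x_k := b_k + 1) = 0`
  have htop : ∀ x, g (update x k (b k + 1)) = 0 := by
    -- `Ψ x := g (update x k (b k + 1))` is invariant along every axis
    have hΨinv : ∀ (i : Fin d) (y : Site d), g (update (y + e i) k (b k + 1)) = g (update y k (b k + 1)) := by
      intro i y
      by_cases hik : i = k
      · subst hik; rw [update_add_single_self]
      rw [update_add_single_of_ne y hik]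
      have hdi := congrFun (congrFun hd (update y k (b k + 1))) i
      simp only [d₀] at hdi
      have hΦ0 : Φ (update y k (b k + 1)) i = 0 := by
        by_cases hiℓ : i = ℓ
        · subst hiℓ; exact h0 _
        by_contra hne
        have := (hsupp _ i hne) k hkℓ
        simp only [update_self] at this
        omega
      rw [hΦ0, sub_eq_zero] at hdi
      exact hdi
    intro x
    -- move far out in the direction `m`
    have hfar := apply_update_eq_of_invariant (f := fun z => g (update z k (b k + 1))) (hΨinv m) x
      (a m - 1)
    rw [← hfar]
    -- every summand vanishes there
    simp only [hg, axisPrim_update]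
    refine Finset.sum_eq_zero fun n _ => ?_
    by_contra hne
    have := (hsupp _ k hne) m hmℓ
    rw [update_of_ne hmk, update_self] at this
    omega
  -- (6) `g` vanishes above the box in the direction `k`
  have habove : ∀ (x : Site d) (n : ℕ), g (update x k (b k + 1 + n)) = 0 := by
    intro x n
    induction n with
    | zero => simpa using htop x
    | succ n ih =>
      have hstep := hgk (update x k (b k + 1 + n))
      rw [update_add_single_eq] at hstep
      have hΦ0 : Φ (update x k (b k + 1 + n)) k = 0 := by
        by_contra hne
        have := (hsupp _ k hne) k hkℓ
        simp only [update_self] at this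
        omega
      rw [hΦ0, sub_eq_zero, ih] at hstep
      push_cast
      rw [← add_assoc]
      exact hstep
  refine ⟨g, hgℓ, hd, fun x hx m' hm' => ?_⟩
  by_cases hmk' : m' = k
  · subst hmk'
    constructor
    · -- below the box `g` is an empty sum
      by_contra hlt
      exact hx (axisPrim_eq_zero_of_le F m' (a m') (by omega))
    · by_contra hlt
      obtain ⟨n, hn⟩ := Int.le.dest (show b m' + 1 ≤ x m' by omega)
      have := habove x n
      rw [hn, update_eq_self] at this
      exact hx this
  · -- a non-vanishing summand lies in the box in every transverse coordinate
    obtain ⟨n, -, hne⟩ := exists_ne_zero_of_axisSum_ne_zero (by simpa [hg, axisPrim] using hx)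
    have := (hsupp _ k hne) m' hm'
    rwa [update_of_ne hmk'] at this

/-! ### The Poincaré lemma with compact supports in degree two -/

/-- Boxes are products: membership of an updated point. [folklore] -/
theorem update_mem_Icc_iff {ℓ : Fin d} {a b x : Site d} {t : ℤ} :
    update x ℓ t ∈ Set.Icc a b ↔ (a ℓ ≤ t ∧ t ≤ b ℓ) ∧ InBoxAway ℓ a b x := by
  simp only [Set.mem_Icc, Pi.le_def, InBoxAway]
  constructor
  · rintro ⟨ha, hb⟩
    refine ⟨⟨by simpa using ha ℓ, by simpa using hb ℓ⟩, fun m hm => ⟨?_, ?_⟩⟩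
    · simpa [update_of_ne hm] using ha m
    · simpa [update_of_ne hm] using hb m
  · rintro ⟨⟨ha, hb⟩, h⟩
    refine ⟨fun m => ?_, fun m => ?_⟩
    · by_cases hm : m = ℓ
      · subst hm; simpa using ha
      · rw [update_of_ne hm]; exact (h m hm).1
    · by_cases hm : m = ℓ
      · subst hm; simpa using hb
      · rw [update_of_ne hm]; exact (h m hm).2

/-- Boxes are products: membership through one coordinate and the others. [folklore] -/
theorem mem_Icc_iff_inBoxAway (ℓ : Fin d) {a b x : Site d} :
    x ∈ Set.Icc a b ↔ (a ℓ ≤ x ℓ ∧ x ℓ ≤ b ℓ) ∧ InBoxAway ℓ a b x := by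
  rw [← update_mem_Icc_iff, update_eq_self]

/-- **Poincaré lemma with compact supports in degree two on `ℤ^d` (`d ≥ 3`), with support
control.** Let `ℓ, k, m` be three distinct axes and `ω` an alternating `2`-cochain
(`ω(x;j,i) = -ω(x;i,j)`, `ω(x;i,i) = 0`) which is closed (`d₂ ω = 0`) and supported in the box
`[a, b]` (base points of non-zero values). Then `ω = d₁ θ` for a `1`-cochain `θ` supported in the
same box. Construction: `θ(x,i) = -∑_{t < x_ℓ} ω((x, x_ℓ := t); i, ℓ)` for `i ≠ ℓ`, `x_ℓ ≤ b_ℓ`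
(integration along the axis `ℓ`), corrected on the top layer `x_ℓ = b_ℓ` by `θ(x, ℓ) = g(x)`,
where `g` is the primitive (`exists_primitive_of_axisInvariant`) of the closed, `ℓ`-invariant
`1`-cochain of column sums `Φ(x; i) = ∑_t ω((x, x_ℓ := t); i, ℓ)`; then `ω - d₁ θ` has no
`ℓ`-components, is closed, hence `ℓ`-invariant, and vanishes below the box. This is the lattice
version of `H²_c(ℝ^d) = 0` for `d ≥ 3` by integration along fibres; it is the statement "a
finite closed vortex is the coboundary of a `1`-form supported in its bounding box" used by the
contour expansion (cf. Forsström–Lenells–Viklund 2022, §2, Poincaré lemma for boxes).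
[cite: ForsstromLenellsViklund2022, §2 (Lemma 2.2, the Poincaré lemma)] -/
theorem exists_d₁_eq_of_d₂_eq_zero {ℓ k m : Fin d} (hkℓ : k ≠ ℓ) (hmℓ : m ≠ ℓ) (hmk : m ≠ k)
    (ω : Site d → Fin d → Fin d → A) (a b : Site d)
    (hanti : ∀ x i j, ω x j i = -ω x i j) (hdiag : ∀ x i, ω x i i = 0)
    (hcl : ∀ x i j k', d₂ ω x i j k' = 0)
    (hsupp : ∀ x i j, ω x i j ≠ 0 → x ∈ Set.Icc a b) :
    ∃ θ : Site d → Fin d → A, d₁ θ = ω ∧ ∀ x i, θ x i ≠ 0 → x ∈ Set.Icc a b := by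
  classical
  -- degenerate box in the direction `ℓ`: then `ω = 0`
  by_cases hab : b ℓ < a ℓ
  · refine ⟨0, ?_, fun x i h => (h rfl).elim⟩
    funext x i j
    simp only [d₁, Pi.zero_apply, add_zero, sub_self]
    by_contra hne
    have := (hsupp x i j (Ne.symm hne))
    rw [mem_Icc_iff_inBoxAway ℓ] at this
    omega
  push Not at hab
  -- support consequences
  have hω0 : ∀ (x : Site d) (i j : Fin d), ¬ (a ℓ ≤ x ℓ ∧ x ℓ ≤ b ℓ) → ω x i j = 0 := by
    intro x i j hx
    by_contra hne
    exact hx ((mem_Icc_iff_inBoxAway ℓ).1 (hsupp x i j hne)).1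
  -- the column sums `Φ` (heights `a_ℓ - 1, …, b_ℓ`) and their number `N`
  set a' : ℤ := a ℓ - 1 with ha'
  set N : ℕ := (b ℓ - a' + 1).toNat with hN
  set Φ : Site d → Fin d → A := fun x i => axisSum (fun y => ω y i ℓ) ℓ a' N x with hΦ
  have hΦℓ : ∀ x, Φ x ℓ = 0 := fun x => by simp [hΦ, axisSum, hdiag]
  have hΦinv : ∀ x i, Φ (x + e ℓ) i = Φ x i := fun x i => by simp [hΦ]
  have hΦsupp : ∀ x i, Φ x i ≠ 0 → InBoxAway ℓ a b x := by
    intro x i hx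
    obtain ⟨n, -, hne⟩ := exists_ne_zero_of_axisSum_ne_zero hx
    exact (update_mem_Icc_iff.1 (hsupp _ _ _ hne)).2
  -- `Φ` is closed
  have hΦcl : ∀ x i j, d₁ Φ x i j = 0 := by
    intro x i j
    by_cases hjℓ : j = ℓ
    · subst hjℓ; simp only [d₁, hΦℓ, hΦinv]; abel
    by_cases hiℓ : i = ℓ
    · subst hiℓ; simp only [d₁, hΦℓ, hΦinv]; abel
    -- sum the closedness of `ω` on the cells `(y_n; i, j, ℓ)` along the column
    have hsum : ∑ n ∈ Finset.range N, d₂ ω (update x ℓ (a' + n)) i j ℓ = 0 :=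
      Finset.sum_eq_zero fun n _ => hcl _ _ _ _
    set f : ℕ → A := fun n => ω (update x ℓ (a' + n)) i j with hf
    have hterm : ∀ n : ℕ, d₂ ω (update x ℓ (a' + n)) i j ℓ =
        ((ω (update (x + e i) ℓ (a' + n)) j ℓ - ω (update x ℓ (a' + n)) j ℓ)
          - (ω (update (x + e j) ℓ (a' + n)) i ℓ - ω (update x ℓ (a' + n)) i ℓ))
          + (f (n + 1) - f n) := by
      intro n
      have h1 : update x ℓ (a' + n) + e i = update (x + e i) ℓ (a' + n) :=
        (update_add_single_of_ne x hiℓ _ _).symm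
      have h2 : update x ℓ (a' + n) + e j = update (x + e j) ℓ (a' + n) :=
        (update_add_single_of_ne x hjℓ _ _).symm
      have h3 : update x ℓ (a' + n) + e ℓ = update x ℓ (a' + (n + 1 : ℕ)) := by
        rw [update_add_single_eq]; push_cast; rw [add_assoc]
      simp only [d₂, hf, h1, h2, h3]
    have hf0 : f 0 = 0 := by
      simp only [hf]
      exact hω0 _ _ _ (by simp only [Nat.cast_zero, add_zero, update_self]; omega)
    have hfN : f N = 0 := by
      simp only [hf]
      exact hω0 _ _ _ (by simp only [update_self]; omega)
    rw [Finset.sum_congr rfl fun n _ => hterm n, Finset.sum_add_distrib, Finset.sum_range_sub,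
      hf0, hfN, sub_zero, add_zero] at hsum
    simp only [Finset.sum_sub_distrib] at hsum
    change (Φ (x + e i) j - Φ x j) - (Φ (x + e j) i - Φ x i) = 0 at hsum
    simp only [d₁]
    have : Φ x i + Φ (x + e i) j - Φ (x + e j) i - Φ x j =
        (Φ (x + e i) j - Φ x j) - (Φ (x + e j) i - Φ x i) := by abel
    rw [this]
    exact hsum
  -- the primitive `g` of `Φ`
  obtain ⟨g, hgℓ, hgd, hgsupp⟩ :=
    exists_primitive_of_axisInvariant hkℓ hmℓ hmk Φ a b hΦℓ hΦinv hΦcl hΦsupp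
  -- the partial column sums and the candidate `θ`
  set P : Fin d → Site d → A := fun i => axisPrim (fun y => ω y i ℓ) ℓ a' with hP
  have hPstep : ∀ i x, P i (x + e ℓ) - P i x = ω x i ℓ := fun i x =>
    axisPrim_add_single_sub _ ℓ a' (fun y hy => hω0 y i ℓ (by omega)) x
  have hPlow : ∀ i (x : Site d), x ℓ ≤ a' → P i x = 0 := fun i x hx =>
    axisPrim_eq_zero_of_le _ ℓ a' hx
  have hPtop : ∀ i (x : Site d), x ℓ = b ℓ → Φ x i = P i x + ω x i ℓ := by
    intro i x hx
    have hx' : update x ℓ (a' + ((b ℓ - a').toNat : ℕ)) = x := by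
      have : a' + (((b ℓ - a').toNat : ℕ) : ℤ) = x ℓ := by omega
      rw [this, update_eq_self]
    have hN' : N = (b ℓ - a').toNat + 1 := by omega
    have hxN : (x ℓ - a').toNat = (b ℓ - a').toNat := by rw [hx]
    simp only [hΦ, hP, axisPrim, hxN]
    rw [hN', axisSum_succ, hx']
  set θ : Site d → Fin d → A := fun x i =>
    if i = ℓ then (if x ℓ = b ℓ then g x else 0) else (if x ℓ ≤ b ℓ then -P i x else 0) with hθ
  -- Claim 1: `d₁ θ (x; i, ℓ) = ω (x; i, ℓ)`
  have hθℓ : ∀ x i, d₁ θ x i ℓ = ω x i ℓ := by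
    intro x i
    by_cases hiℓ : i = ℓ
    · subst hiℓ; rw [d₁_self, hdiag]
    have hxi : (x + e i) ℓ = x ℓ := add_single_apply_of_ne x (Ne.symm hiℓ) 1
    have hxℓ : (x + e ℓ) ℓ = x ℓ + 1 := add_single_apply_self x ℓ 1
    simp only [d₁, hθ, if_pos rfl, if_neg hiℓ, hxi, hxℓ]
    rcases lt_trichotomy (x ℓ) (b ℓ) with hlt | heq | hgt
    · rw [if_pos hlt.le, if_neg hlt.ne, if_pos (by omega), if_neg hlt.ne, ← hPstep i x]
      abel
    · rw [if_pos heq.le, if_pos heq, if_neg (by omega), if_pos heq]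
      have hd0 := congrFun (congrFun hgd x) i
      simp only [d₀] at hd0
      have ht := hPtop i x heq
      -- goal: `-P i x + g (x + e i) - 0 - g x = ω x i ℓ`
      have : -P i x + g (x + e i) - 0 - g x = (g (x + e i) - g x) - P i x := by abel
      rw [this, hd0, ht]
      abel
    · rw [if_neg (by omega), if_neg (by omega), if_neg (by omega), if_neg (by omega)]
      simp only [add_zero, sub_self]
      exact (hω0 x i ℓ (by omega)).symm
  -- Claim 2: `ω - d₁ θ` vanishes
  set ω' : Site d → Fin d → Fin d → A := ω - d₁ θ with hω'
  have hω'ℓ : ∀ x i, ω' x i ℓ = 0 := fun x i => by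
    simp only [hω', Pi.sub_apply, hθℓ, sub_self]
  have hω'ℓ' : ∀ x i, ω' x ℓ i = 0 := fun x i => by
    have h := hω'ℓ x i
    simp only [hω', Pi.sub_apply] at h ⊢
    rw [hanti x i ℓ, d₁_swap θ x i ℓ]
    have : -ω x i ℓ - -d₁ θ x i ℓ = -(ω x i ℓ - d₁ θ x i ℓ) := by abel
    rw [this, h, neg_zero]
  have hω'cl : ∀ x i j k', d₂ ω' x i j k' = 0 := by
    intro x i j k'
    simp only [hω', d₂_sub, d₂_d₁, Pi.sub_apply, hcl, Pi.zero_apply, sub_zero]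
  have hω'inv : ∀ i j (x : Site d), ω' (x + e ℓ) i j = ω' x i j := by
    intro i j x
    have h := hω'cl x i j ℓ
    simp only [d₂, hω'ℓ, sub_zero, zero_add] at h
    -- `h : ω' (x + e ℓ) i j - ω' x i j = 0`
    exact sub_eq_zero.1 h
  have hω'zero : ∀ x i j, ω' x i j = 0 := by
    intro x i j
    by_cases hjℓ : j = ℓ
    · subst hjℓ; exact hω'ℓ x i
    by_cases hiℓ : i = ℓ
    · subst hiℓ; exact hω'ℓ' x j
    rw [← apply_update_eq_of_invariant (f := fun z => ω' z i j) (hω'inv i j) x a']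
    -- at height `a' = a_ℓ - 1` everything vanishes
    set y : Site d := update x ℓ a' with hy'
    have hy : y ℓ = a' := update_self ..
    have hyi : (y + e i) ℓ = a' := by rw [add_single_apply_of_ne _ (Ne.symm hiℓ), hy]
    have hyj : (y + e j) ℓ = a' := by rw [add_single_apply_of_ne _ (Ne.symm hjℓ), hy]
    show ω' y i j = 0
    simp only [hω', Pi.sub_apply, d₁, hθ, if_neg hiℓ, if_neg hjℓ, hy, hyi, hyj]
    rw [hω0 _ i j (by rw [hy]; omega), hPlow i _ hy.le, hPlow j _ hy.le, hPlow j _ hyi.le,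
      hPlow i _ hyj.le]
    simp
  refine ⟨θ, ?_, ?_⟩
  · funext x i j
    have h := hω'zero x i j
    simp only [hω', Pi.sub_apply] at h
    exact (sub_eq_zero.1 h).symm
  · -- Claim 3: support of `θ`
    intro x i hx
    by_cases hiℓ : i = ℓ
    · have hx' : (if x ℓ = b ℓ then g x else 0) ≠ 0 := by simpa [hθ, hiℓ] using hx
      by_cases hxb : x ℓ = b ℓ
      · rw [if_pos hxb] at hx'
        exact (mem_Icc_iff_inBoxAway ℓ).2 ⟨⟨by omega, hxb.le⟩, hgsupp x hx'⟩
      · exact (hx' (if_neg hxb)).elim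
    · have hx' : (if x ℓ ≤ b ℓ then -P i x else 0) ≠ 0 := by simpa [hθ, hiℓ] using hx
      by_cases hxb : x ℓ ≤ b ℓ
      · rw [if_pos hxb, neg_ne_zero] at hx'
        obtain ⟨n, hn, hne⟩ := exists_ne_zero_of_axisSum_ne_zero
          (by simpa [hP, axisPrim] using hx')
        have hmem := update_mem_Icc_iff.1 (hsupp _ _ _ hne)
        refine (mem_Icc_iff_inBoxAway ℓ).2 ⟨⟨?_, hxb⟩, hmem.2⟩
        have h1 : n < (x ℓ - a').toNat := hn
        have h2 := hmem.1.1
        omega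
      · exact (hx' (if_neg hxb)).elim

/-- **Poincaré lemma with compact supports in degree two, `d ≥ 3`** (axes-free form of
`exists_d₁_eq_of_d₂_eq_zero`): on `ℤ^d`, `d ≥ 3`, every alternating closed `2`-cochain with
values in an abelian group and supported in a box `[a, b]` is the coboundary `d₁ θ` of a
`1`-cochain supported in `[a, b]`. [cite: ForsstromLenellsViklund2022, §2 (Lemma 2.2, the Poincaré lemma)] -/
theorem exists_d₁_eq_of_d₂_eq_zero_of_three_le (hd : 3 ≤ d)
    (ω : Site d → Fin d → Fin d → A) (a b : Site d)
    (hanti : ∀ x i j, ω x j i = -ω x i j) (hdiag : ∀ x i, ω x i i = 0)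
    (hcl : ∀ x i j k, d₂ ω x i j k = 0)
    (hsupp : ∀ x i j, ω x i j ≠ 0 → x ∈ Set.Icc a b) :
    ∃ θ : Site d → Fin d → A, d₁ θ = ω ∧ ∀ x i, θ x i ≠ 0 → x ∈ Set.Icc a b :=
  exists_d₁_eq_of_d₂_eq_zero (ℓ := ⟨0, by omega⟩) (k := ⟨1, by omega⟩) (m := ⟨2, by omega⟩)
    (by simp [Fin.ext_iff]) (by simp [Fin.ext_iff]) (by simp [Fin.ext_iff]) ω a b hanti hdiag hcl
    hsupp

end LatticeForm

end Literature.MathematicalPhysics.QuantumFieldTheory
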